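/-
Copyright (c) 2026 the pub-hodgecm-mathlib formalisation cell (harness21).  Prover seat hodgecm-mathlib-K2Liu-p01 (g10), Track B «K2-LIT»,
#184♮ = hLiu418 = `stmt-HodgeConjecture-24832`; #42S organ S1 ROAD W, (G) organ ROW (ρ-mid), step (C2c) part 2 of K2Liu-p26 (g0)'s (M2a) HANDOFF 2026-09-04T16:50:16Z
(K2Liu-p01 (g10) lead of the remaining (M2a) chain, LEAD F0P6-plan (g14) BATCH #58 (7)(vii)): THE BIG-CELL PROFILE ROW `hprof` OF THE WITNESS IMPLEMENTER
`(E′_ε, Γ_ε) := (π, op)(frameMp_{PD} j̃(p₁, p₂))` IN ★ (δ5)'s BINDER BYTES.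
-/
import Summits.HodgeConjecture.HodgeConjecture.Theorems.K2LiuWitnessImplementerCayley      -- ★ (C2c) part 1: the Cayley letter (§1) and the mover property (§2) of `E′_ε`
import HarnessLib

/-!
# Crux `HLiu418`, #42S-S1 ROAD W, (G) organ ROW (ρ-mid), step (C2c) part 2: THE BIG-CELL PROFILE ROW OF THE WITNESS IMPLEMENTER `(E′_ε, Γ_ε)`

Cell `hodgecm-mathlib`, crux item hLiu418 = `stmt-HodgeConjecture-24832` (helper lane `--supports … --as helper`, count-neutral).  THEOREMS ONLY (no `def`, no
instance, no notation, no named-fact hypothesis, no `sorry`).  Currency of ★ (C2c) part 1 `K2LiuWitnessImplementerCayley` ∕ ★ (C2a) `K2LiuTensorMiddleCellHaarDelta` ∕ ★ F4b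
`K2LiuLocalSWTensorBigCellLetters` verbatim (the CM tensor datum `Σ_{𝕍⊗V′}`, Kudla's splitting `localSplittingDatumCM … χ hχ`, outer mover `m₀`, the permutation frame
`P`, `PD = P ⊕ P`, two Cayley-type block implementers `p₁, p₂`).

WHY.  ★ (δ5) `K2LiuInertWitnessPackageOfMoverGeneral.exists_inert_witness_reading_of_mover_general` builds the (G) organ's lattice-pair witness `Φ_ε` on ANY mover-implementer
`(E′, Γ)` handed in WITH its big-cell profile row `hprof : ∀ t ht Ψ, swSectionTensorLoc … m₀ Ψ (w_Δ · n(t)) = γ′ · ∫ ψ_v(−½⟨x, c x⟩) (Γ Ψ)(x) dx` BY VALUE.  Part 1 showed that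
the organ's choice `(E′_ε, Γ_ε) := (π, op)(frameMp_{PD} j̃(p₁, p₂))` is a Cayley-type mover-implementer; THIS FILE turns that into `hprof`:
* §3 **`exists_ne_zero_swSectionTensorLoc_weylDelta_mul_nElem_eq_integral_of_cayleyLetter`** — ★ F4b `…_integral_cm` WITH THE IMPLEMENTER AS A BINDER: for ANY
  Cayley-type mover-implementer `(E′, Γ, B′)` of the tensor datum (generic `n′`, frame `eT`), `∃ γ′ ≠ 0, ∀ t ht Ψ, …` — ★ F4a `exists_ne_zero_swSectionLoc_weylDelta_mul_nElem_eq_integral`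
  at `n′` (`hpar` by ★ `parabolicAtUnipotents_localSplittingDatumCM`), docked by ★ F4b `tensorEmbLoc_weylDelta_mul_nElem`; EXACTLY ★ (δ5)'s `hprof` binder (at
  `hT₀d := isUnit_det_gramR₀ …`).
* §4 **`exists_ne_zero_swSectionTensorLoc_weylDelta_mul_nElem_eq_integral_frameMp_boxLoc`** — (C2c): §3 at `(E′_ε, Γ_ε)` by part 1 §1 (`hW′`) + §2 (`hE′`), `hΓ` = ★
  `MpPsi.toRep_implements`.
USE ((C3), then ★ `K2LiuLocalSWSpanningInertOfPackages`): `obtain ⟨γ′, hγ′, hprof⟩ := §4 …`; feed ★ (δ5) with `E′ := π(frameMp_{PD} j̃(p₁, p₂))`, `hE′ :=` part 1 §2,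
`Γ := op(frameMp_{PD} j̃(p₁, p₂))`, `hΓ := MpPsi.toRep_implements _ _`, `hprof`; the witness' middle row is then ★ (C2b′) read through `Γ_ε Φ_ε = 𝟙_{κ⁻¹B₁} − 𝟙_{κ⁻¹B₂}` and the
explicit phase `c_{t′}`, which (C3) reads under the Levi `m(a)` (★ (M2a-L) `K2LiuWitnessLeviReading`) before ★ (M2b) gives `hfac±`.
References: [Kudla1994] §3, Thm. 3.1; [Kudla1984] §1; [MoeglinVignerasWaldspurger1987] Chap. 2 II.1 Rem. (3), (6), II.6; [Rangarao1993] §3.1 (3.9), Lemma 3.2;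
[Weil1964] n° 13, n° 32, n° 34; [HarrisKudlaSweet1996] §1 (1.11), (1.15)–(1.16); [KudlaRallis1994] §1.
HONEST LABEL.  Count-neutral helper; `HC_CM` is proved only modulo the 7 printed citations (2 remaining named inputs: hLiu418 = `stmt-HodgeConjecture-24832`,
h413 = `stmt-HodgeConjecture-24833`) until rung 0 closes.  NOT here: (C3) (the Levi step and the κ-reading of the middle row), `hfac±`.

## References
* [Kudla1994] S. S. Kudla, *Splitting metaplectic covers of dual reductive pairs*, Israel J. Math. 87 (1994), §3, Thm. 3.1.
* [Kudla1984] S. S. Kudla, *Seesaw dual reductive pairs*, Progr. Math. 46 (1984), §1.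
* [MoeglinVignerasWaldspurger1987] C. Mœglin, M.-F. Vignéras, J.-L. Waldspurger, LNM 1291 (1987), Chap. 2 II.
* [Rangarao1993] R. Ranga Rao, Pacific J. Math. 157 (1993), §3.1, Lemma 3.2.
* [Weil1964] A. Weil, Acta Math. 111 (1964), n° 13, n° 32, n° 34.
* [HarrisKudlaSweet1996] M. Harris, S. Kudla, W. J. Sweet, J. Amer. Math. Soc. 9 (1996), §1.
* [KudlaRallis1994] S. Kudla, S. Rallis, Ann. of Math. 140 (1994), §1.
-/

set_option autoImplicit false
set_option linter.dupNamespace false -- the mandated namespace repeats `HodgeConjecture.HodgeConjecture`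

noncomputable section

open scoped Matrix Kronecker
open NumberField IsDedekindDomain MeasureTheory MeasureTheory.Measure Matrix
open Literature.RepresentationTheory.HeisenbergGroup Literature.RepresentationTheory.HeisenbergGroup.SymplecticMatrix
open Literature.NumberTheory.Automorphic Literature.NumberTheory.Automorphic.UnitaryGroup Literature.NumberTheory.Weil1964
open Literature.NumberTheory.GaloisRepresentations Literature.NumberTheory.GaloisRepresentations.IsNonarchimedeanLocalField
open Literature.RepresentationTheory.HarrisKudlaSweet1996
open Literature.NumberTheory.GelbartRogawski1991 Literature.NumberTheory.GelbartRogawski1991.GRConstruction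
open Literature.NumberTheory.GelbartRogawski1991.AdaptedBlocks
open Literature.NumberTheory.GelbartRogawski1991.UnitaryDualPair
open Literature.NumberTheory.GelbartRogawski1991.UnitaryDualPair.LocalSplitting
open Literature.NumberTheory.GelbartRogawski1991.UnitaryDualPair.LocalSplitting.FrameTransport
open Literature.NumberTheory.GelbartRogawski1991.UnitaryDualPair.LocalSplitting.DoubledBlock
open Literature.NumberTheory.K2Lit.SiegelDoubled
open Summit.HodgeConjecture.HodgeConjecture.Cruxes.HLiu418.K2LiuLocalSWSectionDefs
open Summit.HodgeConjecture.HodgeConjecture.Cruxes.HLiu418.K2LiuLocalSWTensorAdaptedBlocks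
open Summit.HodgeConjecture.HodgeConjecture.Cruxes.HLiu418.K2LiuLocalSWBigCellWords
open Summit.HodgeConjecture.HodgeConjecture.Cruxes.HLiu418.K2LiuLocalSWBigCellFormula
open Summit.HodgeConjecture.HodgeConjecture.Cruxes.HLiu418.K2LiuLocalSWTensorBigCellLetters
open Summit.HodgeConjecture.HodgeConjecture.Cruxes.HLiu418.K2LiuWitnessImplementerCayley

namespace Summit.HodgeConjecture.HodgeConjecture.Cruxes.HLiu418.K2LiuWitnessImplementerProfile

variable (L : Type) [Field L] [NumberField L] [IsCMField L]
variable {N M : ℕ} (e : Fin N × Fin M ≃ Fin 2)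
  (dV : Fin N → L) (hdV : ∀ i, IsCMField.complexConj L (dV i) = dV i)
  (dW : Fin M → L) (hdW : ∀ i, IsCMField.complexConj L (dW i) = dW i)
variable {M₂ M' : ℕ} (eW : Fin M × Fin M₂ ≃ Fin M') (e' : Fin N × Fin M' ≃ Fin (M₂ + M₂))
  (dV' : Fin M₂ → L) (hdV' : ∀ k, IsCMField.complexConj L (dV' k) = dV' k)
  (v : HeightOneSpectrum (𝓞 (Fp L)))
  [MeasurableSpace (v.adicCompletion (Fp L))] [BorelSpace (v.adicCompletion (Fp L))]
  (μ : Measure (v.adicCompletion (Fp L))) [μ.IsAddHaarMeasure]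

/-! ## §3 The big-cell profile row of ANY Cayley-type mover-implementer of the tensor datum (★ F4b with binders) -/

set_option maxHeartbeats 4000000 in -- the doubled CM datum's telescope at the tensor frame (as ★ F4a∕★ F4b `…_integral_cm`, same statement family)
/-- **(C2c) §3 THE BIG-CELL PROFILE ROW OF A CAYLEY-TYPE MOVER-IMPLEMENTER** (★ F4b `exists_ne_zero_swSectionTensorLoc_weylDelta_mul_nElem_eq_integral_cm`
WITH THE IMPLEMENTER AS A BINDER).  For Kudla's CM splitting of the big group `U(𝔻 ⊗ V′)(L⁺_v)` (ANY `n′`, frame `eT`), ANY outer implementer `m₀` over a mover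
(`hm₀`) and ANY inner mover-implementer `(E′, Γ)` (`hE′`, `hΓ`) WITH a Cayley letter `E′ ι′(w_Δ′) E′⁻¹ = (tS J)⁻¹ tS(m B′)` (`hW′`): ONE `γ′ ≠ 0` with, for every
`𝕋₀`-skew `t` and every `Ψ`, `swSectionTensorLoc v s′ m₀ Ψ (w_Δ · n(t)) = γ′ · ∫ ψ_v(−½ ⟨x, c x⟩) · (Γ Ψ)(x) dμ^{⊗(n′+n′)}(x)`, `c = cOfFix 𝕋′ (E′ ι′(n′(reindex epsV (t ⊗ₖ 1))) E′⁻¹)`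
— ★ F4a `exists_ne_zero_swSectionLoc_weylDelta_mul_nElem_eq_integral` at `n′` (`hpar` by ★ `parabolicAtUnipotents_localSplittingDatumCM`), docked by ★ F4b
`tensorEmbLoc_weylDelta_mul_nElem`.  EXACTLY the `hprof` binder of ★ (δ5) `exists_inert_witness_reading_of_mover_general` (at `hT₀d := isUnit_det_gramR₀ …`).
[cite: Kudla1994, §3 Thm. 3.1] [cite: Rangarao1993, §3.1 (3.9), Lemma 3.2 p. 351] [cite: Weil1964, n° 13, n° 32] [cite: MoeglinVignerasWaldspurger1987, Chap. 2 II.6]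
[cite: HarrisKudlaSweet1996, §1 (1.15)–(1.16)] [cite: KudlaRallis1994, §1] -/
theorem exists_ne_zero_swSectionTensorLoc_weylDelta_mul_nElem_eq_integral_of_cayleyLetter {n' : ℕ} (eT : Fin N × Fin M' ≃ Fin n')
    (χ : HeckeCharacter L) (hχ : IsSplittingChar L 1 χ)
    (hT₀d : IsUnit (gramR L eT dV hdV (tensorFrame L dW eW dV') (tensorFrame_real L dW hdW eW dV' hdV')).det)
    (hTv : IsUnit (localGram (Fp L) (n' + n') (gramD (Fp L) n' (gramR L eT dV hdV (tensorFrame L dW eW dV') (tensorFrame_real L dW hdW eW dV' hdV'))) v).det)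
    (m₀ : LocalMp (Fp L) (n' + n') (gramD (Fp L) n' (gramR L eT dV hdV (tensorFrame L dW eW dV') (tensorFrame_real L dW hdW eW dV' hdV'))) v)
    (hm₀ : (deltaLagrangian (Fp L) v n').map (toLin (Fp L) v (MpPsi.proj _ m₀)) = lagrangianY (Fp L) (n' + n') v)
    (E' : LocalSp (Fp L) (n' + n') (gramD (Fp L) n' (gramR L eT dV hdV (tensorFrame L dW eW dV') (tensorFrame_real L dW hdW eW dV' hdV'))) v)
    (hE' : (deltaLagrangian (Fp L) v n').map (toLin (Fp L) v E') = lagrangianY (Fp L) (n' + n') v)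
    (Γ : SchwartzBruhat (Fin (n' + n') → v.adicCompletion (Fp L)) ≃ₗ[ℂ] SchwartzBruhat (Fin (n' + n') → v.adicCompletion (Fp L)))
    (hΓ : Implements (localSchrodinger (Fp L) (n' + n')
      (gramD (Fp L) n' (gramR L eT dV hdV (tensorFrame L dW eW dV') (tensorFrame_real L dW hdW eW dV' hdV'))) v) (ofSymplectic _ E') Γ)
    (B' : GL (Fin (n' + n')) (v.adicCompletion (Fp L)))
    (hW' : E' * iotaD (Fp L) L (IsCMField.complexConj L) (complexConj_imagUnit L) (imagUnit_ne_zero L) (imagUnit_mul_self L) v n'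
          (gramR_isSymm L eT dV hdV (tensorFrame L dW eW dV') (tensorFrame_real L dW hdW eW dV' hdV'))
          (hermD_eq_map_gramD L eT dV hdV (tensorFrame L dW eW dV') (tensorFrame_real L dW hdW eW dV' hdV'))
          (weylDelta (Fp L) L (IsCMField.complexConj L) v n'
            (T₀ := gramR L eT dV hdV (tensorFrame L dW eW dV') (tensorFrame_real L dW hdW eW dV' hdV'))
            (hermD_eq_map_gramD L eT dV hdV (tensorFrame L dW eW dV') (tensorFrame_real L dW hdW eW dV' hdV'))) * E'⁻¹ =
      (transportSp (localGram (Fp L) (n' + n')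
          (gramD (Fp L) n' (gramR L eT dV hdV (tensorFrame L dW eW dV') (tensorFrame_real L dW hdW eW dV' hdV'))) v) hTv
          (SymplecticGroup.symJ _ _))⁻¹ *
        transportSp (localGram (Fp L) (n' + n')
          (gramD (Fp L) n' (gramR L eT dV hdV (tensorFrame L dW eW dV') (tensorFrame_real L dW hdW eW dV' hdV'))) v) hTv (levi B'))
    {m : ℤ} (hm : (adeleAddCharAt (Fp L) v).HasConductorExp m) :
    ∃ γ' : ℂ, γ' ≠ 0 ∧
      ∀ (t : Matrix (Fin 2) (Fin 2) (LocalRing L v))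
        (ht : (t.map (conjLocal L (IsCMField.complexConj L) v))ᵀ * gramS (Fp L) L v 2 (gramR L e dV hdV dW hdW) +
          gramS (Fp L) L v 2 (gramR L e dV hdV dW hdW) * t = 0)
        (Φ : SchwartzBruhat (Fin (n' + n') → v.adicCompletion (Fp L))),
        swSectionTensorLoc L e dV hdV dW hdW eW eT dV' hdV' v
            (localSplittingDatumCM L v μ n' (gramR_isSymm L eT dV hdV (tensorFrame L dW eW dV') (tensorFrame_real L dW hdW eW dV' hdV')) hT₀d
              (hermD_eq_map_gramD L eT dV hdV (tensorFrame L dW eW dV') (tensorFrame_real L dW hdW eW dV' hdV')) χ hχ).localSplitting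
            m₀ Φ
            (weylDelta (Fp L) L (IsCMField.complexConj L) v 2 (T₀ := gramR L e dV hdV dW hdW) (hermD_eq_map_gramD L e dV hdV dW hdW) *
              nElem (Fp L) L (IsCMField.complexConj L) v 2 (T₀ := gramR L e dV hdV dW hdW) (hermD_eq_map_gramD L e dV hdV dW hdW) t ht) =
          γ' * ∫ x : Fin (n' + n') → v.adicCompletion (Fp L),
            ((adeleAddCharAt (Fp L) v
                (-(⅟(2 : v.adicCompletion (Fp L)) *
                  (x ⬝ᵥ (cOfFix (localGram (Fp L) (n' + n')
                      (gramD (Fp L) n' (gramR L eT dV hdV (tensorFrame L dW eW dV') (tensorFrame_real L dW hdW eW dV' hdV'))) v)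
                    (E' * iotaD (Fp L) L (IsCMField.complexConj L) (complexConj_imagUnit L) (imagUnit_ne_zero L) (imagUnit_mul_self L) v n'
                        (gramR_isSymm L eT dV hdV (tensorFrame L dW eW dV') (tensorFrame_real L dW hdW eW dV' hdV'))
                        (hermD_eq_map_gramD L eT dV hdV (tensorFrame L dW eW dV') (tensorFrame_real L dW hdW eW dV' hdV'))
                        (nElem (Fp L) L (IsCMField.complexConj L) v n'
                          (T₀ := gramR L eT dV hdV (tensorFrame L dW eW dV') (tensorFrame_real L dW hdW eW dV' hdV'))
                          (hermD_eq_map_gramD L eT dV hdV (tensorFrame L dW eW dV') (tensorFrame_real L dW hdW eW dV' hdV'))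
                          (Matrix.reindex (epsV e eW eT) (epsV e eW eT) (t ⊗ₖ (1 : Matrix (Fin M₂) (Fin M₂) (LocalRing L v))))
                          (skew_reindex_kronecker_one L e dV hdV dW hdW eW eT dV' hdV' v t ht)) * E'⁻¹) *ᵥ x)))) : ℂ) *
              ((Γ Φ : SchwartzBruhat (Fin (n' + n') → v.adicCompletion (Fp L))) : (Fin (n' + n') → v.adicCompletion (Fp L)) → ℂ) x)
            ∂(Measure.pi fun _ => μ) := by
  obtain ⟨γ', hγ', h⟩ := exists_ne_zero_swSectionLoc_weylDelta_mul_nElem_eq_integral L v μ n'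
    (gramR_isSymm L eT dV hdV (tensorFrame L dW eW dV') (tensorFrame_real L dW hdW eW dV' hdV')) hT₀d
    (hermD_eq_map_gramD L eT dV hdV (tensorFrame L dW eW dV') (tensorFrame_real L dW hdW eW dV' hdV')) hTv
    (localSplittingDatumCM L v μ n' (gramR_isSymm L eT dV hdV (tensorFrame L dW eW dV') (tensorFrame_real L dW hdW eW dV' hdV')) hT₀d
      (hermD_eq_map_gramD L eT dV hdV (tensorFrame L dW eW dV') (tensorFrame_real L dW hdW eW dV' hdV')) χ hχ) E' hE' Γ hΓ m₀ hm₀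
    (fun t ht Φ => parabolicAtUnipotents_localSplittingDatumCM L v μ n'
      (gramR_isSymm L eT dV hdV (tensorFrame L dW eW dV') (tensorFrame_real L dW hdW eW dV' hdV')) hT₀d
      (hermD_eq_map_gramD L eT dV hdV (tensorFrame L dW eW dV') (tensorFrame_real L dW hdW eW dV' hdV')) χ hχ E' hE' Γ hΓ t ht Φ) B' hW' hm
  refine ⟨γ', hγ', fun t ht Φ => ?_⟩
  -- `f₀(w_Δ · n(t)) = F(tensorEmbLoc (w_Δ · n(t))) = F(w_Δ′ · n′(t ⊗ 1))` (★ F4b §2; `congrArg`, no `rw` on the telescope), then ★ F4a at `t ⊗ 1`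
  exact (congrArg (swSectionLoc L v
      (localSplittingDatumCM L v μ n' (gramR_isSymm L eT dV hdV (tensorFrame L dW eW dV') (tensorFrame_real L dW hdW eW dV' hdV')) hT₀d
        (hermD_eq_map_gramD L eT dV hdV (tensorFrame L dW eW dV') (tensorFrame_real L dW hdW eW dV' hdV')) χ hχ).localSplitting m₀ Φ)
    (tensorEmbLoc_weylDelta_mul_nElem L e dV hdV dW hdW eW eT dV' hdV' v t ht)).trans (h _ _ Φ)

/-! ## §4 (C2c): the big-cell profile row of the witness implementer `(E′_ε, Γ_ε) := (π, op)(frameMp_{PD} j̃(p₁, p₂))` -/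

set_option maxHeartbeats 4000000 in -- §3's telescope + the §1∕§2 letters (MEASURED below)
/-- **(C2c) THE BIG-CELL PROFILE ROW OF THE WITNESS IMPLEMENTER `(E′_ε, Γ_ε) := (π, op)(frameMp_{PD} j̃(p₁, p₂))`.**  With (M1)'s∕(C2a)'s frame data (`n′ = M₂ + M₂`,
permutation frame `P` (`hPσ`), `Pᵀ · gramR(𝕍⊗V′) · P = T₁ ⊕ᶠ T₂` (`hP`), `PD = P ⊕ P`), two CAYLEY-TYPE block mover-implementers `p₁, p₂` (`hp_j`, `hW_j`), Kudla's CM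
splitting of the tensor datum and ANY outer `m₀` over a mover: ONE `γ′ ≠ 0` with, for every skew `t` of `U(𝕍^𝔻)(L⁺_v)` and every `Ψ`,
`swSectionTensorLoc … m₀ Ψ (w_Δ · n(t)) = γ′ · ∫ ψ_v(−½ ⟨x, c x⟩) · (Γ_ε Ψ)(x) dμ^{⊗(n′+n′)}(x)`, `c = cOfFix 𝕋′ (E′_ε ι′(n′(reindex epsV (t ⊗ₖ 1))) E′_ε⁻¹)` — §3 at
`(E′_ε, Γ_ε)`: `hE′` is §2, `hΓ` is ★ `MpPsi.toRep_implements`, the Cayley letter is §1.  This is ★ (δ5)'s `hprof` for the (G) organ's choice of implementer; with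
`Ψ := Φ_ε` (★ (δ5) on this `(E′_ε, Γ_ε)`), ★ (C2b′) reads the middle row through `Γ_ε Φ_ε = 𝟙_{κ⁻¹B₁} − 𝟙_{κ⁻¹B₂}` ((C3) next).
[cite: Kudla1994, §3 Thm. 3.1] [cite: Kudla1984, §1] [cite: Rangarao1993, §3.1 (3.9), Lemma 3.2 p. 351] [cite: MoeglinVignerasWaldspurger1987, Chap. 2 II.1 Rem. (3), (6), II.6]
[cite: Weil1964, n° 13, n° 32, n° 34] [cite: HarrisKudlaSweet1996, §1 (1.11), (1.15)–(1.16)] -/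
theorem exists_ne_zero_swSectionTensorLoc_weylDelta_mul_nElem_eq_integral_frameMp_boxLoc (χ : HeckeCharacter L) (hχ : IsSplittingChar L 1 χ)
    (hT₀d : IsUnit (gramR L e' dV hdV (tensorFrame L dW eW dV') (tensorFrame_real L dW hdW eW dV' hdV')).det)
    {σ : Equiv.Perm (Fin (M₂ + M₂))} {T₁ T₂ : Matrix (Fin M₂) (Fin M₂) (Fp L)}
    (P : GL (Fin (M₂ + M₂)) (Fp L)) (hPσ : (P : Matrix (Fin (M₂ + M₂)) (Fin (M₂ + M₂)) (Fp L)) = σ.toPEquiv.toMatrix)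
    (hP : ((P : Matrix (Fin (M₂ + M₂)) (Fin (M₂ + M₂)) (Fp L)))ᵀ *
        gramR L e' dV hdV (tensorFrame L dW eW dV') (tensorFrame_real L dW hdW eW dV' hdV') * (P : Matrix _ _ (Fp L)) =
      UnitaryGroup.finSum M₂ M₂ T₁ T₂)
    (hT₀'d : IsUnit (UnitaryGroup.finSum M₂ M₂ T₁ T₂).det)
    {PD : GL (Fin ((M₂ + M₂) + (M₂ + M₂))) (Fp L)} (hPD : PD = UnitaryGroup.reindexGL (e₂ (M₂ + M₂)) (UnitaryGroup.blockDiagGL (P, P)))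
    (m₀ : LocalMp (Fp L) ((M₂ + M₂) + (M₂ + M₂))
      (gramD (Fp L) (M₂ + M₂) (gramR L e' dV hdV (tensorFrame L dW eW dV') (tensorFrame_real L dW hdW eW dV' hdV'))) v)
    (hm₀ : (deltaLagrangian (Fp L) v (M₂ + M₂)).map (toLin (Fp L) v (MpPsi.proj _ m₀)) = lagrangianY (Fp L) ((M₂ + M₂) + (M₂ + M₂)) v)
    (hT₁ : T₁.IsSymm) (hT₂ : T₂.IsSymm)
    (hTv₁ : IsUnit (localGram (Fp L) (M₂ + M₂) (gramD (Fp L) M₂ T₁) v).det)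
    (hTv₂ : IsUnit (localGram (Fp L) (M₂ + M₂) (gramD (Fp L) M₂ T₂) v).det)
    (p₁ : LocalMp (Fp L) (M₂ + M₂) (gramD (Fp L) M₂ T₁) v)
    (hp₁ : (deltaLagrangian (Fp L) v M₂).map (toLin (Fp L) v (MpPsi.proj _ p₁)) = lagrangianY (Fp L) (M₂ + M₂) v)
    (B₁ : GL (Fin (M₂ + M₂)) (v.adicCompletion (Fp L)))
    (hW₁ : MpPsi.proj _ p₁ * iotaD (Fp L) L (IsCMField.complexConj L) (complexConj_imagUnit L) (imagUnit_ne_zero L)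
        (imagUnit_mul_self L) v M₂ hT₁ rfl (weylDelta (Fp L) L (IsCMField.complexConj L) v M₂ (T₀ := T₁) rfl) * (MpPsi.proj _ p₁)⁻¹ =
      (transportSp (localGram (Fp L) (M₂ + M₂) (gramD (Fp L) M₂ T₁) v) hTv₁ (SymplecticGroup.symJ _ _))⁻¹ *
        transportSp (localGram (Fp L) (M₂ + M₂) (gramD (Fp L) M₂ T₁) v) hTv₁ (levi B₁))
    (p₂ : LocalMp (Fp L) (M₂ + M₂) (gramD (Fp L) M₂ T₂) v)
    (hp₂ : (deltaLagrangian (Fp L) v M₂).map (toLin (Fp L) v (MpPsi.proj _ p₂)) = lagrangianY (Fp L) (M₂ + M₂) v)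
    (B₂ : GL (Fin (M₂ + M₂)) (v.adicCompletion (Fp L)))
    (hW₂ : MpPsi.proj _ p₂ * iotaD (Fp L) L (IsCMField.complexConj L) (complexConj_imagUnit L) (imagUnit_ne_zero L)
        (imagUnit_mul_self L) v M₂ hT₂ rfl (weylDelta (Fp L) L (IsCMField.complexConj L) v M₂ (T₀ := T₂) rfl) * (MpPsi.proj _ p₂)⁻¹ =
      (transportSp (localGram (Fp L) (M₂ + M₂) (gramD (Fp L) M₂ T₂) v) hTv₂ (SymplecticGroup.symJ _ _))⁻¹ *
        transportSp (localGram (Fp L) (M₂ + M₂) (gramD (Fp L) M₂ T₂) v) hTv₂ (levi B₂))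
    {m : ℤ} (hm : (adeleAddCharAt (Fp L) v).HasConductorExp m) :
    ∃ γ' : ℂ, γ' ≠ 0 ∧
      ∀ (t : Matrix (Fin 2) (Fin 2) (LocalRing L v))
        (ht : (t.map (conjLocal L (IsCMField.complexConj L) v))ᵀ * gramS (Fp L) L v 2 (gramR L e dV hdV dW hdW) +
          gramS (Fp L) L v 2 (gramR L e dV hdV dW hdW) * t = 0)
        (Ψ : SchwartzBruhat (Fin ((M₂ + M₂) + (M₂ + M₂)) → v.adicCompletion (Fp L))),
        swSectionTensorLoc L e dV hdV dW hdW eW e' dV' hdV' v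
            (localSplittingDatumCM L v μ (M₂ + M₂) (gramR_isSymm L e' dV hdV (tensorFrame L dW eW dV') (tensorFrame_real L dW hdW eW dV' hdV')) hT₀d
              (hermD_eq_map_gramD L e' dV hdV (tensorFrame L dW eW dV') (tensorFrame_real L dW hdW eW dV' hdV')) χ hχ).localSplitting
            m₀ Ψ
            (weylDelta (Fp L) L (IsCMField.complexConj L) v 2 (T₀ := gramR L e dV hdV dW hdW) (hermD_eq_map_gramD L e dV hdV dW hdW) *
              nElem (Fp L) L (IsCMField.complexConj L) v 2 (T₀ := gramR L e dV hdV dW hdW) (hermD_eq_map_gramD L e dV hdV dW hdW) t ht) =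
          γ' * ∫ x : Fin ((M₂ + M₂) + (M₂ + M₂)) → v.adicCompletion (Fp L),
            ((adeleAddCharAt (Fp L) v
                (-(⅟(2 : v.adicCompletion (Fp L)) *
                  (x ⬝ᵥ (cOfFix (localGram (Fp L) ((M₂ + M₂) + (M₂ + M₂))
                      (gramD (Fp L) (M₂ + M₂) (gramR L e' dV hdV (tensorFrame L dW eW dV') (tensorFrame_real L dW hdW eW dV' hdV'))) v)
                    (MpPsi.proj _ (frameMp (Fp L) v ((M₂ + M₂) + (M₂ + M₂)) PD (transpose_pd_mul_gramD_mul_pd (Fp L) (M₂ + M₂) P hP hPD)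
                        (boxLoc (Fp L) v M₂ M₂ (T₁ := T₁) (T₂ := T₂) (p₁, p₂))) *
                      iotaD (Fp L) L (IsCMField.complexConj L) (complexConj_imagUnit L) (imagUnit_ne_zero L) (imagUnit_mul_self L) v (M₂ + M₂)
                        (gramR_isSymm L e' dV hdV (tensorFrame L dW eW dV') (tensorFrame_real L dW hdW eW dV' hdV'))
                        (hermD_eq_map_gramD L e' dV hdV (tensorFrame L dW eW dV') (tensorFrame_real L dW hdW eW dV' hdV'))
                        (nElem (Fp L) L (IsCMField.complexConj L) v (M₂ + M₂)
                          (T₀ := gramR L e' dV hdV (tensorFrame L dW eW dV') (tensorFrame_real L dW hdW eW dV' hdV'))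
                          (hermD_eq_map_gramD L e' dV hdV (tensorFrame L dW eW dV') (tensorFrame_real L dW hdW eW dV' hdV'))
                          (Matrix.reindex (epsV e eW e') (epsV e eW e') (t ⊗ₖ (1 : Matrix (Fin M₂) (Fin M₂) (LocalRing L v))))
                          (skew_reindex_kronecker_one L e dV hdV dW hdW eW e' dV' hdV' v t ht)) *
                      (MpPsi.proj _ (frameMp (Fp L) v ((M₂ + M₂) + (M₂ + M₂)) PD (transpose_pd_mul_gramD_mul_pd (Fp L) (M₂ + M₂) P hP hPD)
                        (boxLoc (Fp L) v M₂ M₂ (T₁ := T₁) (T₂ := T₂) (p₁, p₂))))⁻¹) *ᵥ x)))) : ℂ) *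
              ((MpPsi.toOp _ (frameMp (Fp L) v ((M₂ + M₂) + (M₂ + M₂)) PD (transpose_pd_mul_gramD_mul_pd (Fp L) (M₂ + M₂) P hP hPD)
                  (boxLoc (Fp L) v M₂ M₂ (T₁ := T₁) (T₂ := T₂) (p₁, p₂))) Ψ :
                  SchwartzBruhat (Fin ((M₂ + M₂) + (M₂ + M₂)) → v.adicCompletion (Fp L))) : (Fin ((M₂ + M₂) + (M₂ + M₂)) → v.adicCompletion (Fp L)) → ℂ) x)
            ∂(Measure.pi fun _ => μ) := by
  -- §1: the Cayley letter of `E′_ε` (`hTv := isUnit_det_localGram_gramD …`, `hTv′` from `hT₀′d`)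
  obtain ⟨B', hW'⟩ := exists_proj_frameMp_boxLoc_conj_iotaD_weylDelta L dV hdV dW hdW eW e' dV' hdV' v P hPσ hP hPD hT₁ hT₂
    (isUnit_det_localGram_gramD (Fp L) v (M₂ + M₂) hT₀d) (isUnit_det_localGram_gramD (Fp L) v (M₂ + M₂) hT₀'d) hTv₁ hTv₂ p₁ B₁ hW₁ p₂ B₂ hW₂
  -- §3 at `(E′_ε, Γ_ε) := (π, op)(frameMp_{PD} j̃(p₁, p₂))`: `hE′` is §2, `hΓ` is ★ `MpPsi.toRep_implements`
  exact exists_ne_zero_swSectionTensorLoc_weylDelta_mul_nElem_eq_integral_of_cayleyLetter L e dV hdV dW hdW eW dV' hdV' v μ e' χ hχ hT₀d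
    (isUnit_det_localGram_gramD (Fp L) v (M₂ + M₂) hT₀d) m₀ hm₀ _
    (map_deltaLagrangian_proj_frameMp_boxLoc L dV hdV dW hdW eW e' dV' hdV' v P hP hPD p₁ hp₁ p₂ hp₂) _ (MpPsi.toRep_implements _ _) B' hW' hm


end Summit.HodgeConjecture.HodgeConjecture.Cruxes.HLiu418.K2LiuWitnessImplementerProfile

end
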